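import Mathlib
import Summits.Ventures.PercRepro2.MeasureBridge
import Summits.Ventures.PercRepro2.Harris

/-!
# The measure bridge for admissible real weights, and Harris–FKG for the product measure
(blind cell PercRepro2, typer-1 g15, 2026-08-26)

`MeasureBridge.lean` identifies the cell's finite-sum law with Mathlib's product Bernoulli measure
`percMeasure p` for unit-interval weights `p : E → I`.  The cell's theorems are stated for real
weights `p : E → ℝ` with `IsProbVec p` (every `p e ∈ [0, 1]`, `Harris.lean`); this file restates
the bridge in that vocabulary —

* `percMeasureOf p hp := percMeasure (toI p hp)`, the product Bernoulli measure of an admissible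
  real weight vector;
* `percMeasureOf_real_apply : (percMeasureOf p hp).real A = prob p A`,
  `integral_percMeasureOf : ∫ ω, f ω ∂(percMeasureOf p hp) = expect p f`,
  `percMeasureOf_real_singleton`, `percMeasureOf_real_cylinder`, `iIndepFun_percMeasureOf`;

— and transports the cell's Harris–FKG inequality (`prob_mul_prob_le_prob_inter`, proved by
pinning induction in `Harris.lean`) to the measure: `measureReal_mul_le_measureReal_inter` —
for increasing events `A`, `B` of the product Bernoulli measure, `μ.real A * μ.real B ≤ μ.real (A ∩ B)`
(and the decreasing / mixed forms).  Own work; standard axioms.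
-/

namespace Summit.Ventures.PercRepro2

namespace MeasureBridge

open MeasureTheory ProbabilityTheory unitInterval

variable {E : Type*} [Fintype E] [DecidableEq E]

omit [Fintype E] [DecidableEq E] in
/-- An admissible real weight vector as a unit-interval weight vector. -/
def toI (p : E → ℝ) (hp : IsProbVec p) : E → I := fun e => ⟨p e, hp.nonneg e, hp.le_one e⟩

omit [Fintype E] [DecidableEq E] in
/-- The real value of `toI p hp e` is `p e`. -/
@[simp] lemma coe_toI (p : E → ℝ) (hp : IsProbVec p) (e : E) : ((toI p hp e : I) : ℝ) = p e :=
  rfl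

omit [Fintype E] [DecidableEq E] in
/-- The real weight vector underlying `toI p hp` is `p`. -/
lemma coe_toI_fun (p : E → ℝ) (hp : IsProbVec p) : (fun e => ((toI p hp e : I) : ℝ)) = p := rfl

/-- The product Bernoulli measure of an admissible real weight vector `p` (edge `e` open with
probability `p e`, independently). -/
noncomputable def percMeasureOf (p : E → ℝ) (hp : IsProbVec p) : Measure (Config E) :=
  percMeasure (toI p hp)

/-- `percMeasureOf p hp` is a probability measure. -/
instance (p : E → ℝ) (hp : IsProbVec p) : IsProbabilityMeasure (percMeasureOf p hp) := by
  unfold percMeasureOf; infer_instance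

/-- **Events**: `(percMeasureOf p hp).real A = prob p A` for every event `A`. -/
theorem percMeasureOf_real_apply (p : E → ℝ) (hp : IsProbVec p) (A : Set (Config E)) :
    (percMeasureOf p hp).real A = prob p A := by
  rw [percMeasureOf, percMeasure_real_apply, coe_toI_fun]

omit [DecidableEq E] in
/-- **Singletons**: the mass of one configuration is the cell's product weight. -/
theorem percMeasureOf_real_singleton (p : E → ℝ) (hp : IsProbVec p) (ω : Config E) :
    (percMeasureOf p hp).real {ω} = weight p ω := by
  rw [percMeasureOf, percMeasure_real_singleton, coe_toI_fun]

/-- **Expectations**: `∫ ω, f ω ∂(percMeasureOf p hp) = expect p f`. -/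
theorem integral_percMeasureOf (p : E → ℝ) (hp : IsProbVec p) (f : Config E → ℝ) :
    ∫ ω, f ω ∂(percMeasureOf p hp) = expect p f := by
  rw [percMeasureOf, integral_percMeasure, coe_toI_fun]

/-- **Cylinders**: `(percMeasureOf p hp).real (cylinder F c) = ∏ e ∈ F, (p e if c e else 1 - p e)`. -/
theorem percMeasureOf_real_cylinder (p : E → ℝ) (hp : IsProbVec p) (F : Finset E)
    (c : Config E) :
    (percMeasureOf p hp).real (cylinder F c) = ∏ e ∈ F, edgeFactor (p e) (c e) := by
  rw [percMeasureOf_real_apply, prob_cylinder]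

omit [DecidableEq E] in
/-- **Independence**: the edge states are independent under `percMeasureOf p hp`. -/
theorem iIndepFun_percMeasureOf (p : E → ℝ) (hp : IsProbVec p) :
    iIndepFun (fun e (ω : Config E) => ω e) (percMeasureOf p hp) :=
  iIndepFun_percMeasure (toI p hp)

/-! ## Harris–FKG for the product Bernoulli measure -/

/-- **Harris–FKG** for the product Bernoulli measure: increasing events are positively
correlated, `μ.real A * μ.real B ≤ μ.real (A ∩ B)`. -/
theorem measureReal_mul_le_measureReal_inter (p : E → ℝ) (hp : IsProbVec p)
    {A B : Set (Config E)} (hA : IsUpperSet A) (hB : IsUpperSet B) :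
    (percMeasureOf p hp).real A * (percMeasureOf p hp).real B ≤
      (percMeasureOf p hp).real (A ∩ B) := by
  simp only [percMeasureOf_real_apply]
  exact prob_mul_prob_le_prob_inter hp hA hB

/-- **Harris–FKG**, decreasing events: `μ.real A * μ.real B ≤ μ.real (A ∩ B)`. -/
theorem measureReal_mul_le_measureReal_inter_of_isLowerSet (p : E → ℝ) (hp : IsProbVec p)
    {A B : Set (Config E)} (hA : IsLowerSet A) (hB : IsLowerSet B) :
    (percMeasureOf p hp).real A * (percMeasureOf p hp).real B ≤
      (percMeasureOf p hp).real (A ∩ B) := by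
  simp only [percMeasureOf_real_apply]
  exact prob_mul_prob_le_prob_inter_of_isLowerSet hp hA hB

/-- **Harris–FKG**, mixed form: a decreasing and an increasing event are negatively correlated,
`μ.real (A ∩ B) ≤ μ.real A * μ.real B`. -/
theorem measureReal_inter_le_measureReal_mul_of_isLowerSet (p : E → ℝ) (hp : IsProbVec p)
    {A B : Set (Config E)} (hA : IsLowerSet A) (hB : IsUpperSet B) :
    (percMeasureOf p hp).real (A ∩ B) ≤
      (percMeasureOf p hp).real A * (percMeasureOf p hp).real B := by
  simp only [percMeasureOf_real_apply]
  exact prob_inter_le_prob_mul_prob_of_isLowerSet hp hA hB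

/-- **Harris–FKG** for monotone observables: `(∫ f) (∫ g) ≤ ∫ f g`. -/
theorem integral_mul_integral_le_integral_mul (p : E → ℝ) (hp : IsProbVec p)
    {f g : Config E → ℝ} (hf : Monotone f) (hg : Monotone g) :
    (∫ ω, f ω ∂(percMeasureOf p hp)) * (∫ ω, g ω ∂(percMeasureOf p hp)) ≤
      ∫ ω, f ω * g ω ∂(percMeasureOf p hp) := by
  simp only [integral_percMeasureOf]
  exact expect_mul_expect_le_expect_mul hp hf hg

end MeasureBridge

end Summit.Ventures.PercRepro2
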